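import Summits.CriticalPhenomena.PercolationContinuityZ3.Theses.PercSupergraphDichotomy
import Summits.CriticalPhenomena.PercolationContinuityZ3.Theorems.PercNearOneGluingNoHeavyLowerTailCSHTheoremOne
import HarnessLib

/-!
# `PercSupergraphDichotomy.PositiveHorn` (stmt-CriticalPhenomena-14281) — SETTLED after continuity

Item `stmt-CriticalPhenomena-14281` of route `CriticalPhenomena/PercSupergraphDichotomy` (support (glue)): `¬ CCDGraphZ3 → SupergraphContinuity`.

A refutation of the CCD horn IS supergraph continuity (`θ ≥ 0`).  p205010 is NOT used.

builds on p205010 (kernel theorem, internal audit signed; external expert review pending) — USED (`CSH.percolationContinuityZ3_holds`).  RSW3 lane, lead gen 28 (prover-prim-rsw3-lead-g28-0):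
'after continuity — the ledger harvest'.
References: G. Kozma, N. Nitzan (2024), Thm. 6 / Conj. 3 [KozmaNitzan2024]; G. Grimmett, *Percolation* (1999), §8 [GrimmettPercolation1999].
-/

noncomputable section

namespace Summit.CriticalPhenomena.PercolationContinuityZ3.Theorems

namespace PercSupergraphDichotomyPositiveHorn

open MeasureTheory Literature.Probability.Percolation Literature.Probability.LatticeModels

/-- **`PercSupergraphDichotomy.PositiveHorn` (stmt-CriticalPhenomena-14281), settled.**  pure logic plus `measureReal_nonneg`.
[cite: KozmaNitzan2024, Thm. 6 with Conj. 3 (p. 15)] -/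
theorem positiveHorn_proof : Summit.CriticalPhenomena.PercolationContinuityZ3.Theses.PercSupergraphDichotomy.PositiveHorn := by
  unfold Summit.CriticalPhenomena.PercolationContinuityZ3.Theses.PercSupergraphDichotomy.PositiveHorn Summit.CriticalPhenomena.PercolationContinuityZ3.Theses.PercSupergraphDichotomy.CCDGraphZ3
    Summit.CriticalPhenomena.PercolationContinuityZ3.Theses.PercSupergraphDichotomy.SupergraphContinuity
  intro hC G h1 h2 h3
  by_contra hne
  exact hC ⟨G, h1, h2, h3, lt_of_le_of_ne (by unfold theta; exact measureReal_nonneg) (Ne.symm hne)⟩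

end PercSupergraphDichotomyPositiveHorn

end Summit.CriticalPhenomena.PercolationContinuityZ3.Theorems

end
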